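import Literature.NumberTheory.GaloisCohomology.Howard2004.DVRSettingEngineGDLineProofs
import Literature.NumberTheory.GaloisCohomology.Howard2004.DVRSettingResidualLocalInputsProofs
import Literature.NumberTheory.GaloisCohomology.Howard2004.ResidualRelaxedLagrangianCountProofs
import Literature.NumberTheory.GaloisCohomology.Howard2004.ResidualLocalPairingLettersProofs
import Literature.NumberTheory.GaloisCohomology.Howard2004.ResidualOrthogonalityIsotropyProofs
import Literature.NumberTheory.GaloisCohomology.Howard2004.ConjugationDatumTransportIndependenceProofs
import Literature.NumberTheory.GaloisCohomology.Howard2004.ResidualEigenlinesProofs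
import Literature.NumberTheory.EllipticCurves.PoitouTateSelmerStructuresConj
import Literature.NumberTheory.GaloisRepresentations.CompatibleRootsOfUnityLogProofs
import HarnessLib

/-!
# Howard 2004, Lemma 1.5.3 on a `DVRSetting`: the ENGINE binders `hdis`, `hGDp/hGDm`, `horp/horm` at the residual
# level with the local letters DISCHARGED, modulo the `τ_v`-eigenline letters (proofs file, GD-LINE-S part R7-final)

Topic `NumberTheory/GaloisCohomology/Howard2004` (sequel to `DVRSettingEngineGDLineProofs` — (GD-line)± and (DICH)± at
the residual level modulo thirteen local letters — and to the residual local files of the cell's split: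
`DVRSettingResidualLocalInputsProofs` (R3: Prop. 1.1.9 for `T̄`, `engine_hdis`, `engine_hsplit`),
`ResidualRelaxedLagrangianCountProofs` (R4: `residual_hcard`), `ResidualLocalPairingLettersProofs` /
`ResidualOrthogonalityIsotropyProofs` (R5: `residual_hnd`, `residual_ht`, `residual_horth`, `residual_hiso`),
`ConjugationDatumTransportIndependenceProofs` (the `G_ℚ`-compatibility `hGQ` of the readings for EVERY conjugation
datum), `ResidualTateDualBijectiveProofs` (R1: the residual readout `λ, exp, Θ̄`)).  THEOREMS ONLY: no definition,
no named fact, no instance, no notation, no `sorry`.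

B. Howard, *The Heegner point Kolyvagin system*, Compositio Math. **140** (2004) = arXiv:1202.6340, Lemma 1.5.3, proof
(p. 10 L10–19, L27–40).  On a `DVRSetting S` (`hy : S.SatisfiesH`) at level `k`, for any residual duality datum `D̄`
(`hDbar`, H.5(c) `hθ` — `exists_residualDualityDatum`), the Poitou–Tate family in its conjugation-compatible form
(`hPT : poitouTate_selmerStructure_duality_conj K` — a THEOREM for THE invariant maps, Summits-side) and Howard's
unit condition `p ∤ #𝓞_K^×` (`hu`; NO `d_K < -4`: R4's count is re-derived here `hd`-free, §1):

* **`engine_gd_dich_of_eigenlines`** — the four ENGINE binders `hGDp ∧ hGDm ∧ horp ∧ horm` of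
  `exists_enginePrime_caseI/II` over all `v ∈ 𝓛^{(2k-1)} ∖ n`, from ONLY the six `τ_v`-eigenline letters
  `hdecf/hdect/hlinef/hlinet/hwitf/hwitt` (R6, `InertEigenlinesProofs` at `(T̄, θ, v)`): the readout is set up inside
  (`exp = log⁻¹` on `μ_{p^{e_k}}`, the Frobenius character `λ` of `R_k`, `Θ̄` bijective — R1), the invariant family at
  `p^{e_k}` is taken from `hPT`, and `hiso`/`hcard`/`hdis`/`hsplit`/`ht`/`horth`/`hnd` are R5/R4/R3 by name, `hGQ` by
  `inv_cohomologyMap_cupProduct_thetaH1_transportH1`.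
* `engine_hdis_of_not_dvd_card_units` — the binder `hdis` (R3's `engine_hdis`, re-exported in the `v ∉ n` shape).

Cell `pub/bsd-print-x9`, G87 = Howard Thm. 1.6.1 (print leaf `stub_h161` of stmt-BirchSwinnertonDyer-22642); seat
`bsd-line-x10b-p1-w8` g11, brick (GD-LINE-S) R7-final.  HONEST FRAMING: the eigenline letters, `hPT`, `hu` remain
hypotheses; `thm161_dvrKolyvaginBound` is NOT proved; no summit statement is proved; the Birch–Swinnerton-Dyer
conjecture is not proved by any of this.

References: [Howard2004HeegnerKolyvagin] Lemma 1.5.3, Lemma 1.5.6, Prop. 1.1.7, Prop. 1.1.9, H.4, H.5;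
[MilneADT2006] I Cor. 2.3, Thm. 4.10.
-/

set_option autoImplicit false

noncomputable section

open Function NumberField IsDedekindDomain Field
open scoped NumberField ContRepresentation Classical

namespace Literature.NumberTheory.GaloisCohomology.Howard2004

open Literature.NumberTheory.GaloisRepresentations
open Literature.NumberTheory.GaloisRepresentations.DiscreteGaloisModule
open Literature.NumberTheory.EllipticCurves

namespace DVRSetting

variable {p : ℕ} [Fact p.Prime] {K : Type} [Field K] [NumberField K]
  {R : Type} [CommRing R] [IsDomain R] [IsDiscreteValuationRing R] [Algebra ℤ_[p] R]
  {N : ℕ → Type} [∀ k, AddCommGroup (N k)] [∀ k, TopologicalSpace (N k)]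
  [∀ k, DiscreteTopology (N k)] [∀ k, Module R (N k)]
  {Rk : ℕ → Type} [∀ k, CommRing (Rk k)] [∀ k, IsLocalRing (Rk k)] [∀ k, TopologicalSpace (Rk k)]
  [∀ k, DiscreteTopology (Rk k)] [∀ k, Algebra ℤ_[p] (Rk k)] [∀ k, Algebra R (Rk k)]
  [∀ k, Module (Rk k) (N k)] [∀ k, IsScalarTower R (Rk k) (N k)]
  {Nbar : Type} [AddCommGroup Nbar] [TopologicalSpace Nbar] [DiscreteTopology Nbar]
  [∀ k, Module (Rk k) Nbar]
  {Nq : ℕ → Finset (HeightOneSpectrum (𝓞 K)) → Type} [∀ k n, AddCommGroup (Nq k n)]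
  [∀ k n, TopologicalSpace (Nq k n)] [∀ k n, DiscreteTopology (Nq k n)]
  [∀ k n, Module (Rk k) (Nq k n)] [∀ k n, Module R (Nq k n)]
  [∀ k n, IsScalarTower R (Rk k) (Nq k n)]

/-- **The ENGINE binder `hdis`** (`H¹_f(K_v,T̄) ∩ H¹_tr(K_v,T̄) = 0` at every engine prime off `n`): R3's
`engine_hdis` (Prop. 1.1.9 for `T̄` under `p ∤ #𝓞_K^×`) in the `v ∉ n` binder shape of `exists_enginePrime_caseI`.
[cite: Howard2004HeegnerKolyvagin, Prop. 1.1.9 (arXiv:1202.6340 p. 6 L17–25)] -/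
theorem engine_hdis_of_not_dvd_card_units (S : DVRSetting p K R N Rk Nbar Nq) (hy : S.SatisfiesH)
    (hu : ¬ p ∣ Nat.card (𝓞 K)ˣ) (k : ℕ) (n : Finset (HeightOneSpectrum (𝓞 K))) :
    ∀ v ∈ S.enginePrimes k, v ∉ n →
      Disjoint (((hy.h1 k).1.propagateStructure (S.t k).cond) (Sum.inr v))
        (transverseStructure p S.ρbar S.jbar (Sum.inr v)) :=
  fun v hv _ => S.engine_hdis hy hu k v hv


/-! ## §1 The count `#A·#A = #H¹(K_v, T̄)` under `p ∤ #𝓞_K^×` (R4's `residual_hcard`, `hd`-free) -/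

/-- **Howard's Lemma 1.5.6 count `#A · #A = #H¹(K_v, T̄)` for `A = loc_v H¹_{F̄_k^v(n)}(K, T̄)` at an engine prime,
`hd`-FREE**: `residual_hcard` (R4, `ResidualRelaxedLagrangianCountProofs`) with its H.4-for-`F̄_k(n)` input (§2 there,
under `d_K < -4`) replaced by the `p ∤ #𝓞_K^×` version `isSelfOrthogonal_residualStructure_modify`
(`ResidualOrthogonalityIsotropyProofs`), and the readout (`exp`, the Frobenius character `λ`, `Θ̄`, the invariant
family) taken as parameters so that one readout serves all letters.  Proof text otherwise as in `residual_hcard`.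
[cite: Howard2004HeegnerKolyvagin, Lemma 1.5.6 (arXiv:1202.6340 Lemma 2.5.6, p. 10 L80–97)] [cite: MilneADT2006, Ch. I Prop. 0.19, Cor. 2.3, Thm. 4.10] -/
theorem residual_hcard_of_not_dvd_card_units [Finite Nbar] [∀ k, Finite (N k)] (S : DVRSetting p K R N Rk Nbar Nq)
    (hy : S.SatisfiesH) (hu : ¬ p ∣ Nat.card (𝓞 K)ˣ) (k : ℕ)
    (hpe : ((p : ℕ) : R) ^ S.e k ∈ IsLocalRing.maximalIdeal R ^ S.e k)
    (exp : ZMod (p ^ S.e k) →+ MuCarrier K (p ^ S.e k))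
    (hexp : ∀ (g : absoluteGaloisGroup K) (x : ZMod (p ^ S.e k)),
      exp (cyclotomicCharacterModPow K p (S.e k) g * x) = mu K (p ^ S.e k) g (exp x))
    (hexpb : Bijective exp) (Dbar : DualityDatum p S.cd S.ρbar (Rk k))
    (hDbar : ∀ s t : N k, Dbar.e (S.πbar k s) (S.πbar k t) =
      algebraMap R (Rk k) S.π ^ (S.e k - 1) * (S.D k).e s t)
    (lam : Rk k →+ ZMod (p ^ S.e k))
    (hlam : ∀ (z : ℤ_[p]) (a : Rk k), lam (algebraMap ℤ_[p] (Rk k) z * a) = PadicInt.toZModPow (S.e k) z * lam a)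
    (hfrob : Bijective ((AddMonoidHom.mul : Rk k →+ Rk k →+ Rk k).compr₂ lam))
    (hΘ : Bijective (Dbar.toTateDual lam hlam exp hexp))
    (inv : LocalInvariants K (p ^ S.e k)) (hperf : inv.IsPerfect) (hSL : inv.SumLocalTermEqZero)
    (hSC : inv.SelmerComplement)
    {n : Finset (HeightOneSpectrum (𝓞 K))} (hn : ↑n ⊆ S.enginePrimes k) :
    ∀ v ∈ S.enginePrimes k, v ∉ n →
      Nat.card ((((hy.h1 k).1.propagateStructure (S.t k).cond).modify (transverseStructure p S.ρbar S.jbar)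
          {v} ∅ n).selmerGroup.map (galoisCohomology.localization S.ρbar (Sum.inr v) 1)) *
        Nat.card ((((hy.h1 k).1.propagateStructure (S.t k).cond).modify (transverseStructure p S.ρbar S.jbar)
          {v} ∅ n).selmerGroup.map (galoisCohomology.localization S.ρbar (Sum.inr v) 1)) =
      Nat.card (galoisCohomology (S.ρbar.toLocal (Sum.inr v)) 1) := by
  intro q hq _
  have hp : p.Prime := Fact.out
  haveI : NeZero (p ^ S.e k) := ⟨pow_ne_zero _ hp.ne_zero⟩
  have hNbar : ∀ m : Nbar, p ^ S.e k • m = 0 := S.residual_pow_e_smul_eq_zero hy k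
  have hqfix : S.cd.σ • q = q := S.sigma_smul_eq_self_of_mem_L hy hq.1
  have hdet := S.residual_hdet hy k hpe exp hexp hexpb Dbar lam hlam hfrob
  have hnlev : (↑n : Set (HeightOneSpectrum (𝓞 K))) ⊆ S.levelPrimes k :=
    hn.trans (S.enginePrimes_subset_levelPrimes hy k)
  -- the places: `S = Σ(F^q(n))`
  have hS : ∀ v : HeightOneSpectrum (𝓞 K), (Sum.inr v : Place K) ∉ ((S.t k).modify S.jbar {q} ∅ n).Sigma →
      ((p ^ S.e k : ℕ) : 𝓞 K) ∉ v.asIdeal ∧ GaloisRep.IsUnramifiedAt v S.ρbar := fun v hv =>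
    ⟨(S.not_mem_and_isUnramifiedAt_of_not_mem_Sigma k (S.e k) v (fun h => hv (Finset.mem_union_left _ h))).1,
      S.isUnramifiedAt_rhobar_of_not_mem_Sigma hy k (fun h => hv (Finset.mem_union_left _ h))⟩
  have hqS : (Sum.inr q : Place K) ∈ ((S.t k).modify S.jbar {q} ∅ n).Sigma := by
    change _ ∈ (S.t k).Sigma ∪ _
    simp
  have h𝓡S : (((hy.h1 k).1.propagateStructure (S.t k).cond).modify (transverseStructure p S.ρbar S.jbar)
      {q} ∅ n).IsUnramifiedOutside ((S.t k).modify S.jbar {q} ∅ n).Sigma := by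
    refine ⟨fun w => Finset.mem_union_left _ ((S.t k).isHoward.isUnramifiedOutside.1 w), fun v hv => ?_⟩
    have hvSig : (Sum.inr v : Place K) ∉ (S.t k).Sigma := fun h => hv (Finset.mem_union_left _ h)
    have hvqn : v ∉ ({q} ∪ ∅ ∪ n : Finset (HeightOneSpectrum (𝓞 K))) := fun h =>
      hv (Finset.mem_union_right _ (Finset.mem_image_of_mem _ h))
    simp only [Finset.union_empty, Finset.mem_union, Finset.mem_singleton, not_or] at hvqn
    rw [SelmerStructure.modify_inr_of_not_mem _ _ (by simpa using hvqn.1) (Finset.notMem_empty _) hvqn.2]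
    exact S.residualStructure_inr_eq_unramifiedSubgroup hy k hvSig
  have hrel : (((hy.h1 k).1.propagateStructure (S.t k).cond).modify (transverseStructure p S.ρbar S.jbar)
      {q} ∅ n) (Sum.inr q) = ⊤ :=
    SelmerStructure.modify_inr_of_mem_relaxed _ _ (Finset.mem_singleton_self q)
  have hoff : ∀ v : HeightOneSpectrum (𝓞 K), v ≠ q →
      (((hy.h1 k).1.propagateStructure (S.t k).cond).modify (transverseStructure p S.ρbar S.jbar) {q} ∅ n)
        (Sum.inr v) =
      (((hy.h1 k).1.propagateStructure (S.t k).cond).modify (transverseStructure p S.ρbar S.jbar) ∅ ∅ n)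
        (Sum.inr v) := fun v hv =>
    (SelmerStructure.modify_level_eq_relaxed_of_ne ((hy.h1 k).1.propagateStructure (S.t k).cond)
      (transverseStructure p S.ρbar S.jbar) q n (Sum.inr v) (fun h => hv (Sum.inr_injective h))).symm
  -- H.4 for `F̄_k(n)` under `p ∤ #𝓞_K^×`, `R_k`-stability, `H¹(K_∞, T̄) = 0`
  have horth := S.isSelfOrthogonal_residualStructure_modify hy hu k hpe exp hexp Dbar hDbar lam hlam hΘ inv hperf hnlev
  have hρ : S.ρbar.IsScalarLinear (Rk k) := S.isScalarLinear_rhobar hy k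
  have hstab : ∀ v : HeightOneSpectrum (𝓞 K), v ≠ q → ∀ b : Rk k,
      ∀ a ∈ (((hy.h1 k).1.propagateStructure (S.t k).cond).modify (transverseStructure p S.ρbar S.jbar) ∅ ∅ n)
        (Sum.inr v),
      galoisCohomology.scalarMapH1 (S.ρbar.toLocal (Sum.inr v)) (DualityDatum.isScalarLinear_toLocal hρ (Sum.inr v))
        b a ∈
        (((hy.h1 k).1.propagateStructure (S.t k).cond).modify (transverseStructure p S.ρbar S.jbar) ∅ ∅ n)
          (Sum.inr v) :=
    fun v _ b a ha => (S.isScalarStable_residualStructure_modify hy k ∅ ∅ n) (Sum.inr v) b ha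
  have hinf : ∀ (w : InfinitePlace K) (c : galoisCohomology S.ρbar 1),
      galoisCohomology.localization S.ρbar (Sum.inl w) 1 c = 0 := fun w c =>
    S.galoisCohomology_rhobar_toLocal_inl_eq_zero hy w _
  exact Dbar.natCard_map_localization_selmerGroup_mul_self_frob lam hlam exp hexp hNbar hρ inv hSL hSC hperf hΘ hdet
    ((S.t k).modify S.jbar {q} ∅ n).Sigma hS _ _ hqfix hqS h𝓡S hrel hoff (fun v _ => horth v) hstab hinf

/-! ## §2 The ENGINE binders with the local letters discharged -/

/-- **Lemma 1.5.3 on a `DVRSetting`, residual level, local letters discharged: the ENGINE binders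
`hGDp ∧ hGDm ∧ horp ∧ horm` of `exists_enginePrime_caseI/II` over all `v ∈ 𝓛^{(2k-1)} ∖ n`**, from the six
`τ_v`-eigenline letters only (R6), for any residual datum `D̄` with H.5(c), under `hPT` (conjugation-compatible
Poitou–Tate family) and `hu` (no `d_K < -4`).  Readout (R1), invariants, `hiso`/`hnd`/`ht`/`horth` (R5), `hcard` (R4), `hdis`/`hsplit`
(R3), `hGQ` (transport independence) are supplied inside by name.
[cite: Howard2004HeegnerKolyvagin, Lemma 1.5.3 proof (arXiv:1202.6340 p. 10 L10–19, L27–40) with Lemma 1.5.6, Prop. 1.1.7, Prop. 1.1.9] [cite: MilneADT2006, Ch. I Cor. 2.3 and Thm. 4.10] -/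
theorem engine_gd_dich_of_eigenlines [Finite Nbar] [∀ k, Finite (N k)] (S : DVRSetting p K R N Rk Nbar Nq)
    (hy : S.SatisfiesH) (k : ℕ) (hu : ¬ p ∣ Nat.card (𝓞 K)ˣ)
    (hPT : poitouTate_selmerStructure_duality_conj K)
    {n : Finset (HeightOneSpectrum (𝓞 K))} (hn : ↑n ⊆ S.enginePrimes k)
    (hdecf : ∀ (v : HeightOneSpectrum (𝓞 K)) (hv : v ∈ S.enginePrimes k), ∀ b ∈ (((hy.h1 k).1.propagateStructure (S.t k).cond) (Sum.inr v)), ∃ b₁ ∈ (((hy.h1 k).1.propagateStructure (S.t k).cond) (Sum.inr v)), ∃ b₂ ∈ (((hy.h1 k).1.propagateStructure (S.t k).cond) (Sum.inr v)), (S.A k).thetaH1 (Sum.inr v) (S.cd.transportH1 S.ρbar v ((S.sigma_smul_eq_self_of_mem_L hy (S.enginePrimes_subset_L k hv)).symm ▸ b₁ : galoisCohomology (S.ρbar.toLocal (Sum.inr (S.cd.σ • v))) 1)) = b₁ ∧ (S.A k).thetaH1 (Sum.inr v) (S.cd.transportH1 S.ρbar v ((S.sigma_smul_eq_self_of_mem_L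 hy (S.enginePrimes_subset_L k hv)).symm ▸ b₂ : galoisCohomology (S.ρbar.toLocal (Sum.inr (S.cd.σ • v))) 1)) = -b₂ ∧ b = b₁ + b₂)
    (hdect : ∀ (v : HeightOneSpectrum (𝓞 K)) (hv : v ∈ S.enginePrimes k), ∀ b ∈ ((transverseStructure p S.ρbar S.jbar) (Sum.inr v)), ∃ b₁ ∈ ((transverseStructure p S.ρbar S.jbar) (Sum.inr v)), ∃ b₂ ∈ ((transverseStructure p S.ρbar S.jbar) (Sum.inr v)), (S.A k).thetaH1 (Sum.inr v) (S.cd.transportH1 S.ρbar v ((S.sigma_smul_eq_self_of_mem_L hy (S.enginePrimes_subset_L k hv)).symm ▸ b₁ : galoisCohomology (S.ρbar.toLocal (Sum.inr (S.cd.σ • v))) 1)) = b₁ ∧ (S.A k).thetaH1 (Sum.inr v) (S.cd.transportH1 S.ρbar v ((S.sigma_smul_eq_self_of_mem_L hy (S.enginePrimes_subset_L k hv)).symm ▸ b₂ : galoisCohomology (S.ρbar.toLocal (Sum.inr (S.cd.σ • v))) 1)) = -b₂ ∧ b = b₁ + b₂)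
    (hlinef : ∀ (v : HeightOneSpectrum (𝓞 K)) (hv : v ∈ S.enginePrimes k), ∀ ε' : ℤ, ε' = 1 ∨ ε' = -1 → ∀ w ∈ (((hy.h1 k).1.propagateStructure (S.t k).cond) (Sum.inr v)), (S.A k).thetaH1 (Sum.inr v) (S.cd.transportH1 S.ρbar v ((S.sigma_smul_eq_self_of_mem_L hy (S.enginePrimes_subset_L k hv)).symm ▸ w : galoisCohomology (S.ρbar.toLocal (Sum.inr (S.cd.σ • v))) 1)) = ε' • w → w ≠ 0 → ∀ b ∈ (((hy.h1 k).1.propagateStructure (S.t k).cond) (Sum.inr v)), (S.A k).thetaH1 (Sum.inr v) (S.cd.transportH1 S.ρbar v ((S.sigma_smul_eq_self_of_mem_L hy (S.enginePrimes_subset_L k hv)).symm ▸ b : galoisCohomology (S.ρbar.toLocal (Sum.inr (S.cd.σ • v))) 1)) = ε' • b → ∃ r : Rk k, b = galoisCohomology.scalarMapH1 (S.ρbar.toLocal (Sum.inr v)) (DualityDatum.isScalarLinear_toLocal (S.isScalarLinear_rhobar hy k) (Sum.inr v)) r w)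
    (hlinet : ∀ (v : HeightOneSpectrum (𝓞 K)) (hv : v ∈ S.enginePrimes k), ∀ ε' : ℤ, ε' = 1 ∨ ε' = -1 → ∀ w ∈ ((transverseStructure p S.ρbar S.jbar) (Sum.inr v)), (S.A k).thetaH1 (Sum.inr v) (S.cd.transportH1 S.ρbar v ((S.sigma_smul_eq_self_of_mem_L hy (S.enginePrimes_subset_L k hv)).symm ▸ w : galoisCohomology (S.ρbar.toLocal (Sum.inr (S.cd.σ • v))) 1)) = ε' • w → w ≠ 0 → ∀ b ∈ ((transverseStructure p S.ρbar S.jbar) (Sum.inr v)), (S.A k).thetaH1 (Sum.inr v) (S.cd.transportH1 S.ρbar v ((S.sigma_smul_eq_self_of_mem_L hy (S.enginePrimes_subset_L k hv)).symm ▸ b : galoisCohomology (S.ρbar.toLocal (Sum.inr (S.cd.σ • v))) 1)) = ε' • b → ∃ r : Rk k, b = galoisCohomology.scalarMapH1 (S.ρbar.toLocal (Sum.inr v)) (DualityDatum.isScalarLinear_toLocal (S.isScalarLinear_rhobar hy k) (Sum.inr v)) r w)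
    (hwitf : ∀ (v : HeightOneSpectrum (𝓞 K)) (hv : v ∈ S.enginePrimes k), ∀ ε' : ℤ, ε' = 1 ∨ ε' = -1 → ∃ w ∈ (((hy.h1 k).1.propagateStructure (S.t k).cond) (Sum.inr v)), w ≠ 0 ∧ (S.A k).thetaH1 (Sum.inr v) (S.cd.transportH1 S.ρbar v ((S.sigma_smul_eq_self_of_mem_L hy (S.enginePrimes_subset_L k hv)).symm ▸ w : galoisCohomology (S.ρbar.toLocal (Sum.inr (S.cd.σ • v))) 1)) = ε' • w)
    (hwitt : ∀ (v : HeightOneSpectrum (𝓞 K)) (hv : v ∈ S.enginePrimes k), ∀ ε' : ℤ, ε' = 1 ∨ ε' = -1 → ∃ w ∈ ((transverseStructure p S.ρbar S.jbar) (Sum.inr v)), w ≠ 0 ∧ (S.A k).thetaH1 (Sum.inr v) (S.cd.transportH1 S.ρbar v ((S.sigma_smul_eq_self_of_mem_L hy (S.enginePrimes_subset_L k hv)).symm ▸ w : galoisCohomology (S.ρbar.toLocal (Sum.inr (S.cd.σ • v))) 1)) = ε' • w) :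
    (∀ v ∈ S.enginePrimes k, v ∉ n →
      letI := (galoisCohomology.moduleH1 (S.ρbar.toLocal (Sum.inr v))
        ((S.isScalarLinear_rhobar hy k).restrictField (Place.Completion (Sum.inr v))));
      Module.length (Rk k) ↥(galoisCohomology.submoduleOfStable ((S.isScalarLinear_rhobar hy k).restrictField (Place.Completion (Sum.inr v)))
        ((((((hy.h1 k).1.propagateStructure (S.t k).cond).modify (transverseStructure p S.ρbar S.jbar) {v} ∅ n).selmerGroup) ⊓
          (semilinearH S.cd.isLift (S.A k).θ.toAddMonoidHom (S.A k).isSemilinear 1 - AddMonoidHom.id _).ker).map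
          (galoisCohomology.localization S.ρbar (Sum.inr v) 1))
        (scalarMapH1_mem_map_localization S.ρbar (S.isScalarLinear_rhobar hy k) (Sum.inr v) (scalarMapH1_mem_inf S.ρbar (S.isScalarLinear_rhobar hy k) (S.scalarMapH1_mem_residualSelmer_modify hy k {v} ∅ n) (S.scalarMapH1_mem_kerSub hy k)))) = 1) ∧
    (∀ v ∈ S.enginePrimes k, v ∉ n →
      letI := (galoisCohomology.moduleH1 (S.ρbar.toLocal (Sum.inr v))
        ((S.isScalarLinear_rhobar hy k).restrictField (Place.Completion (Sum.inr v))));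
      Module.length (Rk k) ↥(galoisCohomology.submoduleOfStable ((S.isScalarLinear_rhobar hy k).restrictField (Place.Completion (Sum.inr v)))
        ((((((hy.h1 k).1.propagateStructure (S.t k).cond).modify (transverseStructure p S.ρbar S.jbar) {v} ∅ n).selmerGroup) ⊓
          (semilinearH S.cd.isLift (S.A k).θ.toAddMonoidHom (S.A k).isSemilinear 1 + AddMonoidHom.id _).ker).map
          (galoisCohomology.localization S.ρbar (Sum.inr v) 1))
        (scalarMapH1_mem_map_localization S.ρbar (S.isScalarLinear_rhobar hy k) (Sum.inr v) (scalarMapH1_mem_inf S.ρbar (S.isScalarLinear_rhobar hy k) (S.scalarMapH1_mem_residualSelmer_modify hy k {v} ∅ n) (S.scalarMapH1_mem_kerAdd hy k)))) = 1) ∧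
    (∀ v ∈ S.enginePrimes k, v ∉ n →
      (((((hy.h1 k).1.propagateStructure (S.t k).cond).modify (transverseStructure p S.ρbar S.jbar) {v} ∅ n).selmerGroup) ⊓
          (semilinearH S.cd.isLift (S.A k).θ.toAddMonoidHom (S.A k).isSemilinear 1 - AddMonoidHom.id _).ker).map (galoisCohomology.localization S.ρbar (Sum.inr v) 1) ≤ (((hy.h1 k).1.propagateStructure (S.t k).cond) (Sum.inr v)) ∨
      (((((hy.h1 k).1.propagateStructure (S.t k).cond).modify (transverseStructure p S.ρbar S.jbar) {v} ∅ n).selmerGroup) ⊓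
          (semilinearH S.cd.isLift (S.A k).θ.toAddMonoidHom (S.A k).isSemilinear 1 - AddMonoidHom.id _).ker).map (galoisCohomology.localization S.ρbar (Sum.inr v) 1) ≤ ((transverseStructure p S.ρbar S.jbar) (Sum.inr v))) ∧
    (∀ v ∈ S.enginePrimes k, v ∉ n →
      (((((hy.h1 k).1.propagateStructure (S.t k).cond).modify (transverseStructure p S.ρbar S.jbar) {v} ∅ n).selmerGroup) ⊓
          (semilinearH S.cd.isLift (S.A k).θ.toAddMonoidHom (S.A k).isSemilinear 1 + AddMonoidHom.id _).ker).map (galoisCohomology.localization S.ρbar (Sum.inr v) 1) ≤ (((hy.h1 k).1.propagateStructure (S.t k).cond) (Sum.inr v)) ∨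
      (((((hy.h1 k).1.propagateStructure (S.t k).cond).modify (transverseStructure p S.ρbar S.jbar) {v} ∅ n).selmerGroup) ⊓
          (semilinearH S.cd.isLift (S.A k).θ.toAddMonoidHom (S.A k).isSemilinear 1 + AddMonoidHom.id _).ker).map (galoisCohomology.localization S.ρbar (Sum.inr v) 1) ≤ ((transverseStructure p S.ρbar S.jbar) (Sum.inr v))) := by
  have hp : p.Prime := Fact.out
  haveI : NeZero (p ^ S.e k) := ⟨pow_ne_zero _ hp.ne_zero⟩
  -- a residual duality datum (H.4 + H.5(c) on `T̄`)
  obtain ⟨Dbar, hDbar, -, hθ⟩ := S.exists_residualDualityDatum hy k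
  have hk' : ((p : ℕ) : R) ^ S.e k ∈ IsLocalRing.maximalIdeal R ^ S.e k :=
    S.natCast_pow_mem_maximalIdeal_pow_of_le hy le_rfl
  have hnlev : (↑n : Set (HeightOneSpectrum (𝓞 K))) ⊆ S.levelPrimes k :=
    hn.trans (S.enginePrimes_subset_levelPrimes hy k)
  -- the trivialisation `exp = log⁻¹` of `μ_{p^{e_k}}`
  have hpK : (p : K) ≠ 0 := Nat.cast_ne_zero.mpr hp.ne_zero
  obtain ⟨log, hlogbij, hlogχ, -⟩ := exists_compatible_muLog K p hpK
  let Lg : MuCarrier K (p ^ S.e k) ≃+ ZMod (p ^ S.e k) := AddEquiv.ofBijective (log (S.e k)) (hlogbij (S.e k))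
  let exp : ZMod (p ^ S.e k) →+ MuCarrier K (p ^ S.e k) := Lg.symm
  have hexpb : Bijective exp := Lg.symm.bijective
  have hexp : ∀ (g : absoluteGaloisGroup K) (x : ZMod (p ^ S.e k)),
      exp (cyclotomicCharacterModPow K p (S.e k) g * x) = mu K (p ^ S.e k) g (exp x) := fun g x => by
    apply Lg.injective
    change Lg (Lg.symm _) = log (S.e k) (mu K _ g (Lg.symm x))
    rw [AddEquiv.apply_symm_apply, hlogχ, show log (S.e k) (Lg.symm x) = Lg (Lg.symm x) from rfl,
      AddEquiv.apply_symm_apply]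
  -- the residual readout: Frobenius character of `R_k`, `Θ̄` bijective (R1)
  obtain ⟨lam, hlam, hfrob, hΘ⟩ := S.exists_residual_toTateDual_bijective hy k hk' exp hexp hexpb Dbar
  -- the conjugation-compatible Poitou–Tate family at `p^{e_k}`
  obtain ⟨inv, hperf, hSL, -, hSC, hconj⟩ := hPT (p ^ S.e k)
  have hfix : ∀ (v : HeightOneSpectrum (𝓞 K)) (hv : v ∈ S.enginePrimes k), S.cd.σ • v = v := fun v hv =>
    (S.sigma_smul_eq_self_of_mem_L hy (S.enginePrimes_subset_L k hv))
  exact S.engine_gd_dich_of_letters hy k Dbar hDbar hθ hn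
    (fun v hv _ => S.residual_hiso hy hu k hk' exp hexp hexpb Dbar hDbar lam hlam hfrob hΘ inv hperf hSL hnlev
      ((S.sigma_smul_eq_self_of_mem_L hy (S.enginePrimes_subset_L k hv))))
    (S.residual_hcard_of_not_dvd_card_units hy hu k hk' exp hexp hexpb Dbar hDbar lam hlam hfrob hΘ inv hperf hSL hSC hn)
    (S.engine_hdis hy hu k) (S.engine_hsplit hy hu k)
    (fun v hv => S.residual_ht hy k Dbar (S.enginePrimes_subset_levelPrimes hy k hv) ((S.sigma_smul_eq_self_of_mem_L hy (S.enginePrimes_subset_L k hv))))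
    hdecf hdect hlinef hlinet hwitf hwitt
    (fun v hv => S.residual_horth hy k hk' exp hexp hexpb Dbar hθ lam hlam hfrob inv hperf ((S.sigma_smul_eq_self_of_mem_L hy (S.enginePrimes_subset_L k hv)))
      (fun b x y => Dbar.inv_cohomologyMap_cupProduct_thetaH1_transportH1 (S.A k) (DualityDatum.lamMul lam b)
        (DualityDatum.lamMul_semilinear lam hlam b) exp hexp hθ inv (hconj S.cd.σ) v
        (by rw [hfix v hv, hfix v hv]) x y))
    (fun v hv => S.residual_hnd hy k hk' exp hexp Dbar lam hlam hΘ inv hperf ((S.sigma_smul_eq_self_of_mem_L hy (S.enginePrimes_subset_L k hv))))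

/-! ## §3 The ENGINE binders with ALL local letters discharged (the eigenline letters of R6 plugged) -/

/-- **Howard's Lemma 1.5.3 on a `DVRSetting`, residual level, COMPLETE: the ENGINE binders `hGDp ∧ hGDm ∧ horp ∧ horm` of
`exists_enginePrime_caseI/II` over all `v ∈ 𝓛^{(2k-1)} ∖ n`**, under H.0–H.5, `p ∤ #𝓞_K^×` and the conjugation-compatible
Poitou–Tate family only — `engine_gd_dich_of_eigenlines` with the six `τ_v`-eigenline letters supplied by
`residual_eigenline_letters` (`ResidualEigenlinesProofs`, R6).  This is the term the closing file of the print leaf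
G87 plugs into `engine_hchebI/II` and `engine_hpar_of_letters`.
[cite: Howard2004HeegnerKolyvagin, Lemma 1.5.3 (arXiv:1202.6340 p. 9 L139 – p. 10 L45) with Lemma 1.5.6, Prop. 1.1.7, Prop. 1.1.9, H.4, H.5] [cite: MilneADT2006, Ch. I Cor. 2.3 and Thm. 4.10] -/
theorem engine_hGD [Finite Nbar] [∀ k, Finite (N k)] (S : DVRSetting p K R N Rk Nbar Nq) (hy : S.SatisfiesH) (k : ℕ)
    (hu : ¬ p ∣ Nat.card (𝓞 K)ˣ) (hPT : poitouTate_selmerStructure_duality_conj K)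
    {n : Finset (HeightOneSpectrum (𝓞 K))} (hn : ↑n ⊆ S.enginePrimes k) :
    (∀ v ∈ S.enginePrimes k, v ∉ n →
      letI := (galoisCohomology.moduleH1 (S.ρbar.toLocal (Sum.inr v))
        ((S.isScalarLinear_rhobar hy k).restrictField (Place.Completion (Sum.inr v))));
      Module.length (Rk k) ↥(galoisCohomology.submoduleOfStable ((S.isScalarLinear_rhobar hy k).restrictField (Place.Completion (Sum.inr v)))
        ((((((hy.h1 k).1.propagateStructure (S.t k).cond).modify (transverseStructure p S.ρbar S.jbar) {v} ∅ n).selmerGroup) ⊓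
          (semilinearH S.cd.isLift (S.A k).θ.toAddMonoidHom (S.A k).isSemilinear 1 - AddMonoidHom.id _).ker).map
          (galoisCohomology.localization S.ρbar (Sum.inr v) 1))
        (scalarMapH1_mem_map_localization S.ρbar (S.isScalarLinear_rhobar hy k) (Sum.inr v) (scalarMapH1_mem_inf S.ρbar (S.isScalarLinear_rhobar hy k) (S.scalarMapH1_mem_residualSelmer_modify hy k {v} ∅ n) (S.scalarMapH1_mem_kerSub hy k)))) = 1) ∧
    (∀ v ∈ S.enginePrimes k, v ∉ n →
      letI := (galoisCohomology.moduleH1 (S.ρbar.toLocal (Sum.inr v))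
        ((S.isScalarLinear_rhobar hy k).restrictField (Place.Completion (Sum.inr v))));
      Module.length (Rk k) ↥(galoisCohomology.submoduleOfStable ((S.isScalarLinear_rhobar hy k).restrictField (Place.Completion (Sum.inr v)))
        ((((((hy.h1 k).1.propagateStructure (S.t k).cond).modify (transverseStructure p S.ρbar S.jbar) {v} ∅ n).selmerGroup) ⊓
          (semilinearH S.cd.isLift (S.A k).θ.toAddMonoidHom (S.A k).isSemilinear 1 + AddMonoidHom.id _).ker).map
          (galoisCohomology.localization S.ρbar (Sum.inr v) 1))
        (scalarMapH1_mem_map_localization S.ρbar (S.isScalarLinear_rhobar hy k) (Sum.inr v) (scalarMapH1_mem_inf S.ρbar (S.isScalarLinear_rhobar hy k) (S.scalarMapH1_mem_residualSelmer_modify hy k {v} ∅ n) (S.scalarMapH1_mem_kerAdd hy k)))) = 1) ∧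
    (∀ v ∈ S.enginePrimes k, v ∉ n →
      (((((hy.h1 k).1.propagateStructure (S.t k).cond).modify (transverseStructure p S.ρbar S.jbar) {v} ∅ n).selmerGroup) ⊓
          (semilinearH S.cd.isLift (S.A k).θ.toAddMonoidHom (S.A k).isSemilinear 1 - AddMonoidHom.id _).ker).map (galoisCohomology.localization S.ρbar (Sum.inr v) 1) ≤ (((hy.h1 k).1.propagateStructure (S.t k).cond) (Sum.inr v)) ∨
      (((((hy.h1 k).1.propagateStructure (S.t k).cond).modify (transverseStructure p S.ρbar S.jbar) {v} ∅ n).selmerGroup) ⊓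
          (semilinearH S.cd.isLift (S.A k).θ.toAddMonoidHom (S.A k).isSemilinear 1 - AddMonoidHom.id _).ker).map (galoisCohomology.localization S.ρbar (Sum.inr v) 1) ≤ ((transverseStructure p S.ρbar S.jbar) (Sum.inr v))) ∧
    (∀ v ∈ S.enginePrimes k, v ∉ n →
      (((((hy.h1 k).1.propagateStructure (S.t k).cond).modify (transverseStructure p S.ρbar S.jbar) {v} ∅ n).selmerGroup) ⊓
          (semilinearH S.cd.isLift (S.A k).θ.toAddMonoidHom (S.A k).isSemilinear 1 + AddMonoidHom.id _).ker).map (galoisCohomology.localization S.ρbar (Sum.inr v) 1) ≤ (((hy.h1 k).1.propagateStructure (S.t k).cond) (Sum.inr v)) ∨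
      (((((hy.h1 k).1.propagateStructure (S.t k).cond).modify (transverseStructure p S.ρbar S.jbar) {v} ∅ n).selmerGroup) ⊓
          (semilinearH S.cd.isLift (S.A k).θ.toAddMonoidHom (S.A k).isSemilinear 1 + AddMonoidHom.id _).ker).map (galoisCohomology.localization S.ρbar (Sum.inr v) 1) ≤ ((transverseStructure p S.ρbar S.jbar) (Sum.inr v))) :=
  S.engine_gd_dich_of_eigenlines hy k hu hPT hn (S.residual_eigenline_letters hy k hu).1
    (S.residual_eigenline_letters hy k hu).2.1 (S.residual_eigenline_letters hy k hu).2.2.1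
    (S.residual_eigenline_letters hy k hu).2.2.2.1 (S.residual_eigenline_letters hy k hu).2.2.2.2.1
    (S.residual_eigenline_letters hy k hu).2.2.2.2.2

end DVRSetting

end Literature.NumberTheory.GaloisCohomology.Howard2004

end
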